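import Mathlib
import Literature.Computability.AlgebraicComplexity.GroupTheoreticMatMul

/-!
# Crux triage evidence (card `signed-halves-designs`, crux `RectangularThmB` = stmt-MatrixMultiplication-10597)

The signed-halves product design in `(ℤ/7)^n` (per-coordinate factors `P = {1,2,3}` on the leg's own
symbol, `{0}` elsewhere; the unique 12-separating-pattern design, blocks `⟨27^k, 3^k, 27^k⟩`, a = 1/3) is
NOT an STPP family on the full composition class: the three words of any combinatorial/affine line of
`{1,2,3}^n ≅ 𝔽₃ⁿ` already violate `IsSTPP`.  Width 7, class (3,1,3): `u = 1133123`, `w = 1133312`,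
`v = 1133231`; instance `(i,j,k) = (u,w,v)` with the six explicit group elements below.
Consequence: a valid index set must be a cap set in `𝔽₃^{7k}` (all six Latin patterns and the diagonal
are non-separating), so two-leg tightness needs cap sets of size `(7/3^{6/7})^{7k(1-o(1))} = 2.7302^{n(1-o(1))}`.
-/

open Literature.Computability.AlgebraicComplexity

namespace SignedHalvesTriage

abbrev H7 := Fin 7 → ZMod 7

/-- the positive half of `(ℤ/7)ˣ` -/
def P : Finset (ZMod 7) := {1, 2, 3}

/-- coordinate factor of leg `leg` (0 = A, 1 = B, 2 = C) at a coordinate carrying symbol `s`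
(symbols 1,2,3 coded 0,1,2) -/
def legSet (leg s : Fin 3) : Finset (ZMod 7) := if leg = s then P else {0}

instance (leg : Fin 3) (word : Fin 7 → Fin 3) : DecidablePred fun x : H7 => ∀ j, x j ∈ legSet leg (word j) :=
  fun _ => inferInstance

/-- `signedSet leg word = {x : x_j ∈ P if word_j = leg, x_j = 0 otherwise}` -/
def signedSet (leg : Fin 3) (word : Fin 7 → Fin 3) : Finset H7 :=
  Finset.univ.filter fun x => ∀ j, x j ∈ legSet leg (word j)

/-- the line: u = 1133123, w = 1133312, v = 1133231 (coded 0/1/2), indexed 0 ↦ u, 1 ↦ w, 2 ↦ v -/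
def words : Fin 3 → Fin 7 → Fin 3 :=
  ![![0, 0, 2, 2, 0, 1, 2], ![0, 0, 2, 2, 2, 0, 1], ![0, 0, 2, 2, 1, 2, 0]]

def A (i : Fin 3) : Finset H7 := signedSet 0 (words i)
def B (i : Fin 3) : Finset H7 := signedSet 1 (words i)
def C (i : Fin 3) : Finset H7 := signedSet 2 (words i)

-- explicit witnesses (coordinates 1..7)
def sA' : H7 := ![1, 1, 0, 0, 1, 0, 0]   -- ∈ A u  (i = 0)
def sA  : H7 := ![1, 1, 0, 0, 0, 0, 1]   -- ∈ A v  (k = 2)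
def tB  : H7 := ![0, 0, 0, 0, 0, 1, 0]   -- ∈ B u  (i = 0)
def tB' : H7 := ![0, 0, 0, 0, 0, 0, 1]   -- ∈ B w  (j = 1)
def uC  : H7 := ![0, 0, 1, 1, 1, 0, 0]   -- ∈ C w  (j = 1)
def uC' : H7 := ![0, 0, 1, 1, 0, 1, 0]   -- ∈ C v  (k = 2)

theorem mem_signedSet {leg : Fin 3} {word : Fin 7 → Fin 3} {x : H7}
    (h : ∀ j, x j ∈ legSet leg (word j)) : x ∈ signedSet leg word :=
  Finset.mem_filter.2 ⟨Finset.mem_univ _, h⟩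

/-- The signed-halves design on (any family containing) a line of the composition class is not STPP. -/
theorem signedHalves_line_not_isSTPP : ¬ IsSTPP A B C := by
  intro h
  have hsA : sA ∈ A 2 := mem_signedSet (by decide)
  have hsA' : sA' ∈ A 0 := mem_signedSet (by decide)
  have htB : tB ∈ B 0 := mem_signedSet (by decide)
  have htB' : tB' ∈ B 1 := mem_signedSet (by decide)
  have huC : uC ∈ C 1 := mem_signedSet (by decide)
  have huC' : uC' ∈ C 2 := mem_signedSet (by decide)
  have key := h 0 1 2 sA hsA sA' hsA' tB htB tB' htB' uC huC uC' huC' (by decide)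
  exact absurd key.1 (by decide)

end SignedHalvesTriage
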